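import Mathlib
import Summits.Ventures.HodgeRepro.Tier4.Common.AdelicDefs
import Summits.Ventures.HodgeRepro.Tier4.Line1.PlaneDefs
import Summits.Ventures.HodgeRepro.Tier4.Line1.AdicIntegersCompact
import Summits.Ventures.HodgeRepro.Tier4.Line1.C7Components
import Summits.Ventures.HodgeRepro.Tier4.Line1.C7BoxCompact

/-!
# Tier4/Line1/C7Assembly — C7 (the fibration over the stabiliser) from its rungs (C7.4 of the C7 census)

Blind re-derivation cell `pub-hodge-repro`, Tier 4, LINE L1, rung C7 (typed census `proofs/t4/L1/C7-rungs-sig.lean`,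
t4-L1-p4 with t4-L1-p2).  `exists_compact_stab_mul_of_rungs'`: C7 for a definite plane from the three walls —
(C7.1) the local fibration at every finite place, (C7.1∞) at every infinite place, (C7.2) integral transitivity at
almost all finite places — and the two glue rungs still being landed by other seats, (C7.3a) «every compact subset of
`𝔸_k⁴` lies in a box» and (C7.3c) «a family of local unitary matrices, integral outside a finite set, is the family of
components of one element of `GA W`», ALL DISPLAYED as hypotheses; the landed glue (C7.3b `isCompact_adelicBox`, C7.3d
the components calculus) does the rest.  Given `g` with `v₀ g ∈ C₀`: put `C₀` in a box over `S ⊇ S₀`; at every place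
write the component `g_v = s_v κ_v` with `κ_v` in the local compact window (`v ∈ S`, `w | ∞`) or integral (`v ∉ S`) and
`s_v` fixing `v₀`; glue `κ := (κ_v)_v ∈ GA W`; then `s := g κ⁻¹` fixes the adelic `v₀` place by place, and `κ` lies in
the compact adelic box.  HC_CM is NOT proved by anyone in this repository.
-/

set_option autoImplicit false
noncomputable section
namespace Summit.Ventures.HodgeRepro.Tier4.Line1
open NumberField IsDedekindDomain HeightOneSpectrum Topology Common Matrix

section LocalGroup

variable {k : Type} [Field k] [NumberField k] (W : PlaneData k)

/-- A local unitary matrix has an invertible determinant (`det h = ±1`). -/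
theorem isUnit_det_of_mem_localU (hW : IsDefinite W) (v : HeightOneSpectrum (𝓞 k))
    {h : Matrix (Fin 4) (Fin 4) (v.adicCompletion k)} (hh : h ∈ localU W v) : IsUnit h.det :=
  IsUnit.of_mul_eq_one _ (det_mul_self_eq_one_of_unitary W _ (det_map_ne_zero_of_isDefinite W _ hW) hh.2)

omit [NumberField k] in
/-- A local unitary matrix at an infinite place has an invertible determinant. -/
theorem isUnit_det_of_mem_localUInf (hW : IsDefinite W) (w : InfinitePlace k)
    {h : Matrix (Fin 4) (Fin 4) w.Completion} (hh : h ∈ localUInf W w) : IsUnit h.det :=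
  IsUnit.of_mul_eq_one _ (det_mul_self_eq_one_of_unitary W _ (det_map_ne_zero_of_isDefinite W _ hW) hh.2)

/-- If `x κ = x h` and `κ` is invertible then `h κ⁻¹` fixes `x`. -/
theorem vecMul_mul_inv_eq {F : Type} [Field F] {x : Fin 4 → F} {h κ : Matrix (Fin 4) (Fin 4) F}
    (hκ : IsUnit κ.det) (heq : x ᵥ* κ = x ᵥ* h) : x ᵥ* (h * κ⁻¹) = x := by
  rw [← Matrix.vecMul_vecMul, ← heq, Matrix.vecMul_vecMul, Matrix.mul_nonsing_inv _ hκ, Matrix.vecMul_one]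

end LocalGroup

section Assembly

variable {k : Type} [Field k] [NumberField k] (W : PlaneData k)

/-- (C7.4) **THE ASSEMBLY OF C7** with every rung not yet on the tree DISPLAYED: from (C7.1) `h1`, (C7.1∞) `h1'`,
(C7.2) `h2`, (C7.3a) `h3a` and (C7.3c) `h3c`, for a definite plane, a non-zero rational `v₀` and a compact
`C₀ ⊆ 𝔸_k⁴`, the set `{g ∈ U(W)(𝔸_k) : v₀ g ∈ C₀}` is contained in `Stab(v₀)(𝔸_k) · K` with `K` compact.  The compact
`K` is the adelic box of the local windows (`isCompact_adelicBox`). -/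
theorem exists_compact_stab_mul_of_rungs' (hW : IsDefinite W)
    (h1 : ∀ (v : HeightOneSpectrum (𝓞 k)) (v₀ : Fin 4 → k), v₀ ≠ 0 →
      ∀ C : Set (Fin 4 → v.adicCompletion k), IsCompact C →
        ∃ K : Set (Matrix (Fin 4) (Fin 4) (v.adicCompletion k)), IsCompact K ∧
          ∀ h ∈ localU W v, finRat v v₀ ᵥ* h ∈ C →
            ∃ s ∈ localU W v, finRat v v₀ ᵥ* s = finRat v v₀ ∧ ∃ κ ∈ localU W v, κ ∈ K ∧ h = s * κ)
    (h1' : ∀ (w : InfinitePlace k) (v₀ : Fin 4 → k), v₀ ≠ 0 →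
      ∀ C : Set (Fin 4 → w.Completion), IsCompact C →
        ∃ K : Set (Matrix (Fin 4) (Fin 4) w.Completion), IsCompact K ∧
          ∀ h ∈ localUInf W w, infRat w v₀ ᵥ* h ∈ C →
            ∃ s ∈ localUInf W w, infRat w v₀ ᵥ* s = infRat w v₀ ∧
              ∃ κ ∈ localUInf W w, κ ∈ K ∧ h = s * κ)
    (h2 : ∀ v₀ : Fin 4 → k, v₀ ≠ 0 → ∃ S₀ : Finset (HeightOneSpectrum (𝓞 k)), ∀ v ∉ S₀, ∀ h ∈ localU W v,
      (∀ i, (finRat v v₀ ᵥ* h) i ∈ v.adicCompletionIntegers k) →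
        ∃ κ ∈ localUInt W v, finRat v v₀ ᵥ* κ = finRat v v₀ ᵥ* h)
    (h3a : ∀ C₀ : Set (Fin 4 → Ad k), IsCompact C₀ →
      ∃ S : Finset (HeightOneSpectrum (𝓞 k)),
        ∃ Cf : ∀ v : HeightOneSpectrum (𝓞 k), Set (Fin 4 → v.adicCompletion k),
          ∃ Ci : ∀ w : InfinitePlace k, Set (Fin 4 → w.Completion),
            (∀ v ∈ S, IsCompact (Cf v)) ∧ (∀ w, IsCompact (Ci w)) ∧
              ∀ x ∈ C₀, (∀ w, infVec w x ∈ Ci w) ∧ (∀ v ∈ S, finVec v x ∈ Cf v) ∧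
                ∀ v ∉ S, ∀ i, (x i).2 v ∈ v.adicCompletionIntegers k)
    (h3c : ∀ (S : Finset (HeightOneSpectrum (𝓞 k)))
      (κf : ∀ v : HeightOneSpectrum (𝓞 k), Matrix (Fin 4) (Fin 4) (v.adicCompletion k))
      (κi : ∀ w : InfinitePlace k, Matrix (Fin 4) (Fin 4) w.Completion),
      (∀ v, κf v ∈ localU W v) → (∀ w, κi w ∈ localUInf W w) → (∀ v ∉ S, κf v ∈ localUInt W v) →
        ∃ κ : GA W, (∀ v, finMat v (GA.mat W κ) = κf v) ∧ ∀ w, infMat w (GA.mat W κ) = κi w)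
    (v₀ : Fin 4 → k) (hv₀ : v₀ ≠ 0) {C₀ : Set (Fin 4 → Ad k)} (hC₀ : IsCompact C₀) :
    ∃ K : Set (GA W), IsCompact K ∧ ∀ g : GA W,
      (fun i => algebraMap k (Ad k) (v₀ i)) ᵥ* GA.mat W g ∈ C₀ →
        ∃ s : GA W, (fun i => algebraMap k (Ad k) (v₀ i)) ᵥ* GA.mat W s =
          (fun i => algebraMap k (Ad k) (v₀ i)) ∧ ∃ κ ∈ K, g = s * κ := by
  classical
  obtain ⟨S₁, Cf, Ci, hCf, hCi, hbox⟩ := h3a C₀ hC₀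
  obtain ⟨S₀, hS₀⟩ := h2 v₀ hv₀
  let S : Finset (HeightOneSpectrum (𝓞 k)) := S₁ ∪ S₀
  -- compact local windows at every finite place: the given ones on `S₁`, the integral cube elsewhere
  let Cf' : ∀ v : HeightOneSpectrum (𝓞 k), Set (Fin 4 → v.adicCompletion k) := fun v =>
    if v ∈ S₁ then Cf v
    else Set.pi Set.univ fun _ => (v.adicCompletionIntegers k : Set (v.adicCompletion k))
  have hCf' : ∀ v, IsCompact (Cf' v) := fun v => by
    by_cases hv : v ∈ S₁
    · simp only [Cf', hv, if_true]
      exact hCf v hv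
    · simp only [Cf', hv, if_false]
      exact isCompact_univ_pi fun _ => isCompact_adicCompletionIntegers k v
  choose Kf hKfc hKf using fun v => h1 v v₀ hv₀ (Cf' v) (hCf' v)
  choose Ki hKic hKi using fun w => h1' w v₀ hv₀ (Ci w) (hCi w)
  refine ⟨adelicBox W S Kf Ki, isCompact_adelicBox W hW S Kf (fun v _ => hKfc v) Ki hKic, ?_⟩
  intro g hgC
  obtain ⟨hxi, hxf, hxint⟩ := hbox _ hgC
  have hxv : ∀ v, finVec v ((fun i => algebraMap k (Ad k) (v₀ i)) ᵥ* GA.mat W g) =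
      finRat v v₀ ᵥ* finMat v (GA.mat W g) := fun v => by
    rw [finVec_vecMul, finVec_algebraMap]
  have hxw : ∀ w, infVec w ((fun i => algebraMap k (Ad k) (v₀ i)) ᵥ* GA.mat W g) =
      infRat w v₀ ᵥ* infMat w (GA.mat W g) := fun w => by
    rw [infVec_vecMul, infVec_algebraMap]
  -- the local factors `κ_v` at the finite places
  have hloc : ∀ v, ∃ κ ∈ localU W v, finRat v v₀ ᵥ* κ = finRat v v₀ ᵥ* finMat v (GA.mat W g) ∧
      (v ∈ S → κ ∈ Kf v) ∧ (v ∉ S → κ ∈ localUInt W v) := by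
    intro v
    by_cases hvS : v ∈ S
    · have hmem : finRat v v₀ ᵥ* finMat v (GA.mat W g) ∈ Cf' v := by
        rw [← hxv]
        by_cases hv1 : v ∈ S₁
        · simp only [Cf', hv1, if_true]
          exact hxf v hv1
        · simp only [Cf', hv1, if_false]
          intro i _
          exact hxint v hv1 i
      obtain ⟨s, _, hsfix, κ, hκ, hκK, hsk⟩ := hKf v _ (finMat_mem_localU W g v) hmem
      refine ⟨κ, hκ, ?_, fun _ => hκK, fun h => absurd hvS h⟩
      rw [hsk, ← Matrix.vecMul_vecMul, hsfix]
    · have hv1 : v ∉ S₁ := fun h => hvS (Finset.mem_union_left _ h)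
      have hv0 : v ∉ S₀ := fun h => hvS (Finset.mem_union_right _ h)
      have hint : ∀ i, (finRat v v₀ ᵥ* finMat v (GA.mat W g)) i ∈ v.adicCompletionIntegers k := by
        intro i
        rw [← hxv]
        exact hxint v hv1 i
      obtain ⟨κ, hκ, hκeq⟩ := hS₀ v hv0 _ (finMat_mem_localU W g v) hint
      exact ⟨κ, hκ.1, hκeq, fun h => absurd h hvS, fun _ => hκ⟩
  choose κf hκf hκfeq hκfS hκfint using hloc
  -- the local factors `κ_w` at the infinite places
  have hlocw : ∀ w, ∃ κ ∈ localUInf W w,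
      infRat w v₀ ᵥ* κ = infRat w v₀ ᵥ* infMat w (GA.mat W g) ∧ κ ∈ Ki w := by
    intro w
    have hmem : infRat w v₀ ᵥ* infMat w (GA.mat W g) ∈ Ci w := by
      rw [← hxw]
      exact hxi w
    obtain ⟨s, _, hsfix, κ, hκ, hκK, hsk⟩ := hKi w _ (infMat_mem_localUInf W g w) hmem
    refine ⟨κ, hκ, ?_, hκK⟩
    rw [hsk, ← Matrix.vecMul_vecMul, hsfix]
  choose κi hκi hκieq hκiK using hlocw
  -- glue
  obtain ⟨κ, hκfin, hκinf⟩ := h3c S κf κi hκf hκi hκfint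
  refine ⟨g * κ⁻¹, ?_, κ, ?_, (inv_mul_cancel_right g κ).symm⟩
  · apply vec_ext_of_components
    · intro v
      rw [finVec_vecMul, finVec_algebraMap, finMat_GA_mul, finMat_GA_inv, hκfin v]
      exact vecMul_mul_inv_eq (isUnit_det_of_mem_localU W hW v (hκf v)) (hκfeq v)
    · intro w
      rw [infVec_vecMul, infVec_algebraMap, infMat_GA_mul, infMat_GA_inv, hκinf w]
      exact vecMul_mul_inv_eq (isUnit_det_of_mem_localUInf W hW w (hκi w)) (hκieq w)
  · simp only [adelicBox, Set.mem_setOf_eq]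
    refine ⟨fun w => ?_, fun v hv => ?_, fun v hv => ?_⟩
    · rw [hκinf w]
      exact hκiK w
    · rw [hκfin v]
      exact hκfS v hv
    · rw [hκfin v]
      exact hκfint v hv

end Assembly

end Summit.Ventures.HodgeRepro.Tier4.Line1
end
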